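import Summits.ResolutionOfSingularities.ResolutionOfSingularities.Theorems.FrobeniusLadderFRationalResolutionClauseOfRetractRegular
import Summits.ResolutionOfSingularities.ResolutionOfSingularities.Theorems.FrobeniusLadderFRationalResolutionRetractLocalization
import Summits.ResolutionOfSingularities.ResolutionOfSingularities.Theorems.FrobeniusLadderFRationalResolutionRegularRingLocalization
import Literature.AlgebraicGeometry.Resolution.TameQuotientSingularitiesResolutionProofs
import Mathlib.RingTheory.GradedAlgebra.Basic
import Mathlib.RingTheory.Flat.FaithfullyFlat.Algebra
import Mathlib.AlgebraicGeometry.Morphisms.Etale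
import Mathlib.Algebra.CharP.Algebra
import HarnessLib

/-!
# Crux `FrobeniusLadder.FRationalResolution` (stmt-ResolutionOfSingularities-15317), line `redirect` —
# diagonalizable quotient singularities with regular DOMAIN charts are weakly F-regular
# (consistency of the X₂ split `stub_quotientModel` / `stub_diagonalizableQuotientResolution`)

Line `redirect` cuts rung 4′ (`WeaklyFRegularResolution`: weakly F-regular ⇒ resolvable) into
`stub_quotientModel` (weakly F-regular `X` ⇒ proper birational model with diagonalizable quotient
singularities presented by étale charts `Spec S₀ → X'`, `S` regular finitely generated graded by a
finite abelian group) and `stub_diagonalizableQuotientResolution` (such `X'` are resolvable). This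
file proves that the interface class is INSIDE the weakly F-regular class in characteristic `p`
(for DOMAIN charts): every local ring of an integral `X` carrying such charts is a domain in which
every ideal is tightly closed — so, in characteristic `p` and for domain charts,
`stub_diagonalizableQuotientResolution` is IMPLIED BY the piece `WeaklyFRegularResolution` it serves
(it is not a strengthening of rung 4′). Mechanism: the degree-`0` projection is a REYNOLDS OPERATOR
(an `S₀`-linear retraction `S → S₀`), direct summands of regular rings have all ideals tightly closed
(`stub_clause_of_retract_regular`, c5), this localizes (`stub_retract_localization`), and the clause
descends along the faithfully flat stalk maps of the étale charts (pure subrings: `IB ∩ A = I`).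

* `exists_retract_gradeZero` — the Reynolds retraction `ρ : S →+ S₀`, `ρ(t) = t`, `ρ(t g) = t ρ(g)`;
* `gradeZero_clause` — `S` a regular domain of characteristic `p` ⇒ `S₀` is a domain with every ideal
  tightly closed; `localization_gradeZero_clause` — the same for every localization `(S₀)_𝔮`;
  `stalk_Spec_gradeZero_clause` — and for the stalks of `Spec S₀`;
* `clause_of_injective_of_comap_map_eq` — the clause descends along an injective ring map with
  `f⁻¹(I·T) = I` (pure subrings; faithfully flat extensions; isomorphisms);
* `clause_stalk_of_flat` — and hence along the stalk maps of a flat morphism onto integral stalks;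
* `weaklyFRegular_stalk_of_regularDomainCharts` — **an integral `X/k`, `char k = p`, every point of
  which lies in the image of an étale `Spec S₀ → X` with `S` a regular DOMAIN of finite type graded
  by a finite abelian group, has weakly F-regular stalks** (the hypothesis `hW` of
  `stub_quotientModel`, verbatim).

Honest label: consistency/bookkeeping for the line (no stub is closed); DOMAIN charts only (the
stub allows disconnected regular `S`). No definitions, no named facts, no sorry.
[folklore; cite: HochsterHuneke1990, Prop. 4.12 (direct summands of regular rings are weakly F-regular)]
-/

noncomputable section

-- single-problem summit: the doubled namespace component is forced
set_option linter.dupNamespace false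

open CategoryTheory DirectSum AlgebraicGeometry
open Literature.AlgebraicGeometry.Resolution
open Literature.AlgebraicGeometry.Resolution.DiagonalizableQuotient

namespace Summit.ResolutionOfSingularities.ResolutionOfSingularities.Theorems.FRationalResolution.GradeZeroWeaklyFRegular

/-! ## The Reynolds retraction onto the degree-zero part -/

section Graded

variable {k : Type} [Field k] {A : Type} [DecidableEq A] [AddCommGroup A] {S : Type} [CommRing S]
  [Algebra k S] (𝒮 : A → Submodule k S) [GradedAlgebra 𝒮]

/-- **The degree-`0` projection is a Reynolds operator**: an additive retraction `ρ : S → S₀` of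
the inclusion `S₀ ⊆ S` which is `S₀`-linear (`ρ(t g) = t ρ(g)` for `t ∈ S₀`; graded multiplication,
Mathlib `DirectSum.coe_decompose_mul_of_left_mem_zero`). [folklore] -/
theorem exists_retract_gradeZero :
    ∃ ρ : S →+ (𝒮 0), (∀ t : 𝒮 0, ρ (algebraMap (𝒮 0) S t) = t) ∧
      ∀ (t : 𝒮 0) (g : S), ρ (algebraMap (𝒮 0) S t * g) = t * ρ g := by
  classical
  refine ⟨{ toFun := fun s => decompose 𝒮 s 0
            map_zero' := by rw [decompose_zero]; rfl
            map_add' := fun a b => by rw [decompose_add]; rfl }, fun t => ?_, fun t g => ?_⟩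
  · apply Subtype.ext
    change (decompose 𝒮 (t : S) 0 : S) = t
    exact decompose_of_mem_same 𝒮 t.2
  · apply Subtype.ext
    change (decompose 𝒮 ((t : S) * g) 0 : S) = ((t * decompose 𝒮 g 0 : 𝒮 0) : S)
    rw [coe_decompose_mul_of_left_mem_zero 𝒮 t.2]
    rfl

/-- **The degree-`0` part of a regular domain of characteristic `p` is a domain in which every
ideal is tightly closed** (weakly F-regular, in the route's inline form): `S₀ ⊆ S` is a direct
summand by the Reynolds retraction, and direct summands of regular domains have all ideals tightly
closed (`stub_clause_of_retract_regular`). [cite: HochsterHuneke1990, Prop. 4.12] -/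
theorem gradeZero_clause (p : ℕ) [Fact p.Prime] [CharP k p] [IsDomain S] [IsRegularRing S] :
    IsDomain (𝒮 0) ∧ ∀ I : Ideal (𝒮 0), ∀ y c : 𝒮 0, c ≠ 0 →
      (∀ e : ℕ, c * y ^ p ^ e ∈ Ideal.span ((fun z : 𝒮 0 => z ^ p ^ e) '' (I : Set (𝒮 0)))) →
      y ∈ I := by
  obtain ⟨ρ, h1, h2⟩ := exists_retract_gradeZero 𝒮
  haveI : CharP S p := charP_of_injective_algebraMap (algebraMap k S).injective p
  exact stub_clause_of_retract_regular p (algebraMap (𝒮 0) S) ρ (algebraMap_gradeZero_injective 𝒮)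
    h1 h2

/-- **Every localization `(S₀)_𝔮` at a prime is a domain with every ideal tightly closed**
(`S` a regular domain of characteristic `p`): the retraction localizes
(`stub_retract_localization`) to `(S₀)_𝔮 → T⁻¹S`, `T = S₀ ∖ 𝔮`, and `T⁻¹S` is again a regular
domain of characteristic `p`. [cite: HochsterHuneke1990, Prop. 4.12] -/
theorem localization_gradeZero_clause (p : ℕ) [Fact p.Prime] [CharP k p] [IsDomain S]
    [IsRegularRing S] (𝔮 : Ideal (𝒮 0)) [𝔮.IsPrime] :
    IsDomain (Localization.AtPrime 𝔮) ∧ ∀ I : Ideal (Localization.AtPrime 𝔮),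
      ∀ y c : Localization.AtPrime 𝔮, c ≠ 0 →
      (∀ e : ℕ, c * y ^ p ^ e ∈ Ideal.span ((fun z : Localization.AtPrime 𝔮 => z ^ p ^ e) ''
        (I : Set (Localization.AtPrime 𝔮)))) → y ∈ I := by
  obtain ⟨ρ, h1, h2⟩ := exists_retract_gradeZero 𝒮
  set Λ : 𝒮 0 →+* S := algebraMap (𝒮 0) S with hΛdef
  have hΛ : Function.Injective Λ := algebraMap_gradeZero_injective 𝒮
  obtain ⟨Λ', ρ', hΛ', h1', h2', -⟩ := stub_retract_localization Λ ρ hΛ h1 h2 𝔮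
  -- the big ring `T⁻¹S`: a regular domain of characteristic `p`
  have hT : 𝔮.primeCompl.map Λ ≤ nonZeroDivisors S := by
    rintro _ ⟨u, hu, rfl⟩
    refine mem_nonZeroDivisors_of_ne_zero fun h0 => hu ?_
    have hu0 : u = 0 := hΛ (by rw [h0, map_zero])
    rw [hu0]; exact 𝔮.zero_mem
  haveI : IsDomain (Localization (𝔮.primeCompl.map Λ)) := IsLocalization.isDomain_localization hT
  haveI : IsRegularRing (Localization (𝔮.primeCompl.map Λ)) := stub_isRegularRing_localization _
  haveI : CharP S p := charP_of_injective_algebraMap (algebraMap k S).injective p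
  haveI : CharP (Localization (𝔮.primeCompl.map Λ)) p :=
    charP_of_injective_ringHom (f := algebraMap S (Localization (𝔮.primeCompl.map Λ)))
      (IsLocalization.injective (Localization (𝔮.primeCompl.map Λ)) hT) p
  exact stub_clause_of_retract_regular p Λ' ρ' hΛ' h1' h2'

end Graded

/-! ## Descent of the clause along pure / faithfully flat maps -/

/-- **The weakly-F-regular clause descends along pure extensions**: if `f : R → T` is injective
with `f⁻¹(I T) = I` for every ideal `I` of `R` (e.g. `R` a direct summand of `T`, or `T` faithfully
flat over `R`, or `f` an isomorphism), and `T` is a domain with every ideal tightly closed, then so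
is `R` (`c yᵠ ∈ I^[q]` maps to `f(c) f(y)ᵠ ∈ (IT)^[q]`, so `f y ∈ IT`, so `y ∈ f⁻¹(IT) = I`).
[cite: HochsterHuneke1990, Prop. 4.12] -/
theorem clause_of_injective_of_comap_map_eq (p : ℕ) {R T : Type} [CommRing R] [CommRing T]
    (f : R →+* T) (hf : Function.Injective f) (hcm : ∀ I : Ideal R, (I.map f).comap f = I)
    (hT : IsDomain T ∧ ∀ J : Ideal T, ∀ y c : T, c ≠ 0 →
      (∀ e : ℕ, c * y ^ p ^ e ∈ Ideal.span ((fun z : T => z ^ p ^ e) '' (J : Set T))) → y ∈ J) :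
    IsDomain R ∧ ∀ I : Ideal R, ∀ y c : R, c ≠ 0 →
      (∀ e : ℕ, c * y ^ p ^ e ∈ Ideal.span ((fun z : R => z ^ p ^ e) '' (I : Set R))) → y ∈ I := by
  haveI := hT.1
  refine ⟨hf.isDomain f, fun I y c hc h => ?_⟩
  have hfc : f c ≠ 0 := fun h0 => hc (hf (by rw [h0, map_zero]))
  have key : ∀ e : ℕ, f c * f y ^ p ^ e ∈
      Ideal.span ((fun z : T => z ^ p ^ e) '' (I.map f : Set T)) := by
    intro e
    have h1 : f (c * y ^ p ^ e) ∈ (Ideal.span ((fun z : R => z ^ p ^ e) '' (I : Set R))).map f :=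
      Ideal.mem_map_of_mem f (h e)
    rw [map_mul, map_pow, Ideal.map_span] at h1
    refine Ideal.span_mono ?_ h1
    rintro _ ⟨_, ⟨z, hz, rfl⟩, rfl⟩
    exact ⟨f z, Ideal.mem_map_of_mem f hz, by simp only [map_pow]⟩
  have hy : f y ∈ I.map f := hT.2 (I.map f) (f y) (f c) hfc key
  rw [← hcm I]
  exact Ideal.mem_comap.mpr hy

/-- The clause transports along ring isomorphisms (a special case of the previous theorem).
[folklore] -/
theorem clause_of_ringEquiv (p : ℕ) {R T : Type} [CommRing R] [CommRing T] (e : R ≃+* T)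
    (hT : IsDomain T ∧ ∀ J : Ideal T, ∀ y c : T, c ≠ 0 →
      (∀ n : ℕ, c * y ^ p ^ n ∈ Ideal.span ((fun z : T => z ^ p ^ n) '' (J : Set T))) → y ∈ J) :
    IsDomain R ∧ ∀ I : Ideal R, ∀ y c : R, c ≠ 0 →
      (∀ n : ℕ, c * y ^ p ^ n ∈ Ideal.span ((fun z : R => z ^ p ^ n) '' (I : Set R))) → y ∈ I :=
  clause_of_injective_of_comap_map_eq p e.toRingHom e.injective
    (fun _ => Ideal.comap_map_of_bijective e.toRingHom e.bijective) hT

/-- **The clause descends along the stalk maps of a flat morphism onto integral stalks**: if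
`φ : Y ⟶ X` is flat and the local ring of `Y` at `y` is a domain with every ideal tightly closed,
then so is the local ring of `X` at `φ y` (the stalk map is a flat local homomorphism of local
rings, hence faithfully flat, hence pure: `f⁻¹(I·𝒪_{Y,y}) = I`, Mathlib
`Ideal.comap_map_eq_self_of_faithfullyFlat`). [folklore] -/
theorem clause_stalk_of_flat (p : ℕ) {Y X : Scheme.{0}} (φ : Y ⟶ X) [Flat φ] (y : Y)
    (hY : IsDomain (Y.presheaf.stalk y) ∧ ∀ J : Ideal (Y.presheaf.stalk y),
      ∀ u c : Y.presheaf.stalk y, c ≠ 0 →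
      (∀ e : ℕ, c * u ^ p ^ e ∈ Ideal.span ((fun z : Y.presheaf.stalk y => z ^ p ^ e) ''
        (J : Set (Y.presheaf.stalk y)))) → u ∈ J) :
    IsDomain (X.presheaf.stalk (φ.base y)) ∧ ∀ I : Ideal (X.presheaf.stalk (φ.base y)),
      ∀ u c : X.presheaf.stalk (φ.base y), c ≠ 0 →
      (∀ e : ℕ, c * u ^ p ^ e ∈ Ideal.span ((fun z : X.presheaf.stalk (φ.base y) => z ^ p ^ e) ''
        (I : Set (X.presheaf.stalk (φ.base y))))) → u ∈ I := by
  have hflat : (φ.stalkMap y).hom.Flat := Flat.stalkMap φ y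
  algebraize [(φ.stalkMap y).hom]
  haveI : IsLocalHom (algebraMap (X.presheaf.stalk (φ.base y)) (Y.presheaf.stalk y)) :=
    inferInstanceAs (IsLocalHom (φ.stalkMap y).hom)
  haveI : Module.FaithfullyFlat (X.presheaf.stalk (φ.base y)) (Y.presheaf.stalk y) :=
    Module.FaithfullyFlat.of_flat_of_isLocalHom
  exact clause_of_injective_of_comap_map_eq p (algebraMap _ _)
    (FaithfulSMul.algebraMap_injective _ _)
    (fun I => Ideal.comap_map_eq_self_of_faithfullyFlat I) hY

/-! ## Stalks of the quotient chart and of `X` -/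

section Charts

variable {k : Type} [Field k] {A : Type} [DecidableEq A] [AddCommGroup A] {S : Type} [CommRing S]
  [Algebra k S] (𝒮 : A → Submodule k S) [GradedAlgebra 𝒮]

/-- **The stalks of the quotient chart `Spec S₀` are domains with every ideal tightly closed**
(`S` a regular domain of characteristic `p`, any grading group). [cite: HochsterHuneke1990, Prop. 4.12] -/
theorem stalk_Spec_gradeZero_clause (p : ℕ) [Fact p.Prime] [CharP k p] [IsDomain S]
    [IsRegularRing S] (v : Spec (.of (𝒮 0))) :
    IsDomain ((Spec (.of (𝒮 0))).presheaf.stalk v) ∧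
      ∀ I : Ideal ((Spec (.of (𝒮 0))).presheaf.stalk v),
      ∀ u c : (Spec (.of (𝒮 0))).presheaf.stalk v, c ≠ 0 →
      (∀ e : ℕ, c * u ^ p ^ e ∈ Ideal.span ((fun z : (Spec (.of (𝒮 0))).presheaf.stalk v =>
        z ^ p ^ e) '' (I : Set ((Spec (.of (𝒮 0))).presheaf.stalk v)))) → u ∈ I := by
  letI : Algebra (𝒮 0) ((Spec (.of (𝒮 0))).presheaf.stalk v) :=
    inferInstanceAs (Algebra (𝒮 0) ((Spec.structureSheaf (𝒮 0)).presheaf.stalk v))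
  haveI : IsLocalization.AtPrime ((Spec (.of (𝒮 0))).presheaf.stalk v) v.asIdeal :=
    StructureSheaf.IsLocalization.to_stalk (𝒮 0) v
  let e : (Spec (.of (𝒮 0))).presheaf.stalk v ≃+* Localization.AtPrime v.asIdeal :=
    (IsLocalization.algEquiv v.asIdeal.primeCompl ((Spec (.of (𝒮 0))).presheaf.stalk v)
      (Localization.AtPrime v.asIdeal)).toRingEquiv
  exact clause_of_ringEquiv p (T := Localization.AtPrime v.asIdeal) e
    (localization_gradeZero_clause 𝒮 p v.asIdeal)

end Charts

/-- **Diagonalizable quotient singularities with regular DOMAIN charts are weakly F-regular.**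
Let `k` be a field of characteristic `p` and `X` an integral `k`-scheme every point of which lies in
the image of an étale `k`-morphism `Spec S₀ → X`, where `S` is a regular DOMAIN of finite type over
`k` graded by a finite abelian group `A` and `S₀` is its degree-`0` part. Then every local ring of
`X` is a domain in which every ideal is tightly closed — the hypothesis `hW` of `stub_quotientModel`
and of rung 4′ `WeaklyFRegularResolution`, verbatim. (Consequently, in characteristic `p` and for
domain charts, `stub_diagonalizableQuotientResolution` follows from `WeaklyFRegularResolution`.)
[cite: HochsterHuneke1990, Prop. 4.12] -/
theorem weaklyFRegular_stalk_of_regularDomainCharts (p : ℕ) [Fact p.Prime] (k : Type) [Field k]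
    [CharP k p] (X : Scheme.{0}) (g : X ⟶ Spec (.of k)) [IsIntegral X]
    (hq : ∀ x : X, ∃ (A : Type) (_ : AddCommGroup A) (_ : Finite A) (_ : DecidableEq A)
        (S : Type) (_ : CommRing S) (_ : Algebra k S) (𝒮 : A → Submodule k S)
        (_ : GradedAlgebra 𝒮), Algebra.FiniteType k S ∧ IsRegularRing S ∧ IsDomain S ∧
        ∃ φ : Spec (.of (𝒮 0)) ⟶ X, Etale φ ∧ x ∈ Set.range φ ∧
          φ ≫ g = Spec.map (CommRingCat.ofHom (algebraMap k (𝒮 0))))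
    (x : X) :
    IsDomain (X.presheaf.stalk x) ∧ ∀ I : Ideal (X.presheaf.stalk x),
      ∀ y c : X.presheaf.stalk x, c ≠ 0 →
      (∀ e : ℕ, c * y ^ p ^ e ∈ Ideal.span ((fun z : X.presheaf.stalk x => z ^ p ^ e) ''
        (I : Set (X.presheaf.stalk x)))) → y ∈ I := by
  obtain ⟨A, _, _, _, S, _, _, 𝒮, _, -, _, _, φ, _, ⟨v, rfl⟩, -⟩ := hq x
  exact clause_stalk_of_flat p φ v (stalk_Spec_gradeZero_clause 𝒮 p v)

end Summit.ResolutionOfSingularities.ResolutionOfSingularities.Theorems.FRationalResolution.GradeZeroWeaklyFRegular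

end
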